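/-
Copyright (c) 2026 the pub-hodgecm-mathlib formalisation cell (harness21).  Prover seat hodgecm-mathlib-LH7-p06 (g3), req620 Track A «(D-RAM) FOUR-FRAME» squad
((β₂) road (R-36), the K6 road; K6 desk LH4-p16 (g3) WORD #6 (C) «LH7-p06: (d″-T) THE DIGIT TOTALS OF THE ONE CHART» — pure residue counting of a σ-fixed integral digit system
by valuation shell, over ★ LH4-p09 ∕ LH4-p08's fixed-class representative systems), 2026-09-05.
-/
import Summits.HodgeConjecture.HodgeConjecture.Theorems.F0P3cDyRamDiagonalFixedClassSystems   -- ★ (LH4-p09 (g3)): `card_eq_card_of_repr`, `exists_repr_fixedBall_card`; brings ★ `exists_fixed_class_representatives`, ★ Lit `v_varpi_pow`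
import Literature.NumberTheory.Automorphic.UnitaryThreeFourFrameDefs                          -- ★ `IsRamifiedQuadraticDatum`
import HarnessLib

/-!
# Crux `H413`, line LH4 «(D-RAM) FOUR-FRAME» — (β₂) road, K6-(d″-T): «THE DIGIT TOTALS OF THE ONE CHART» — a σ-fixed integral digit system modulo `|ϖ|^n` has
# `(q − 1)·q^{⌈(n − 2t)∕2⌉ − 1}` members on the shell `|V| = |ϖ|^{2t}` (`2t < n`) and `q^{⌈(n − 2t)∕2⌉}` members in the ball `|V| ≤ |ϖ|^{2t}` (`2t ≤ n`); hence shell `N − i`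
# holds `(q − 1)·q^{i−1}·β` digits where `β` counts the ball of level `2N`

Cell `hodgecm-mathlib` (D-0151), FLOOR 0, crux item H413 = `stmt-HodgeConjecture-24833`, route of record `HCCMUnconditional`; squad F0∕P3c∕LH4 (hand LH7-p06); lane
`--supports stmt-HodgeConjecture-24833 --as helper` (count-neutral).  THEOREMS ONLY (no `def`, no instance, no notation, no `sorry`, default heartbeats); ONE field `E` with the wild
datum `IsRamifiedQuadraticDatum σ ϖ d tE` (only `σ² = 1`, `v∘σ = v`, `|ϖ| = exp(−1)`, even fixed valuations, `|ϖ − σϖ| = |ϖ|^d` are used) and `[Finite 𝓀[E]]`, `q := Nat.card 𝓀[E]`.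
THE DIGIT SYSTEM is the count sockets' `Rd` (★ p863833 ∕ LH4-p18's K6-0: `hRd2` covering, `hRd3` separation, modulus `r`) in LH7-p08 (g3)'s ONE chart ★ p864361 §7 (`|κ₀| = 1`,
`|ξ₀| = exp 2N`), with the members σ-FIXED INTEGRAL (`hRd1`) and the modulus a power `r = |ϖ|^n`; its cells are valuation shells of `V`: tower `(b + 2i, b)` ↔ `|V| = exp(2i − 2N)
= |ϖ|^{2(N−i)}` (★ `sphereClause_oneChart_tower_iff`), diagonal ↔ `|V| ≤ exp(−2N) = |ϖ|^{2N}` (★ `sphereClause_oneChart_diag_iff`).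
WHY (K6 desk WORD #6 (C); the L-half of ‹K6-(f′)› by the table road, ★ p864447 `crossDensity_of_tables`' `hL…` letters = these TOTALS × LH7-p08's class SPLIT (d″-Q)).  The filter
of `Rd` by a shell (resp. a ball) whose level is coarser than the modulus is ITSELF a complete irredundant system of the σ-fixed elements of that exact level (resp. ball) — covering
by `hRd2` + the ultrametric equality `|g| = |f|` for `|f − g| ≤ |ϖ|^n < |f|`, separation by `hRd3` (§1) — so by ★ `card_eq_card_of_repr` its size is that of ★ LH4-p08's exact-level
system `exists_fixed_class_representatives` (`(q−1)q^{⌈ρ∕2⌉−1}`, `ρ = n − 2t ≥ 1`) resp. ★ LH4-p09's ball system `exists_repr_fixedBall_card` (`q^{⌈ρ∕2⌉}`) (§2); §3 reads the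
two off against each other: shell `N − i` (`1 ≤ i ≤ N`) holds `(q−1)·q^{i−1}·β` digits, `β = #(Rd ∩ ball 2N) = q^{⌈(n−2N)∕2⌉} ≠ 0` — the `D_i = (q−1)q^{i−1}β` of SIG-K6f′-R2 (2).
RESOLUTION: any modulus `n` with `2N + 1 ≤ n` serves the totals (the diagonal ball must be split by the modulus); the consumer's `n` is the finest (hI)∕(hF) precision of the window.
* §1 `filter_level_repr`, `filter_ball_repr` (the filters are representative systems); §2 `card_filter_level_eq`, `card_filter_ball_eq`; §3 HEAD `card_filter_shell_eq_mul_card_ball`,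
  `card_filter_ball_ne_zero`.
WHAT IS NOT CLAIMED: the class split per shell ((d″-Q), LH7-p08), the sphere-clause dictionary (★ p864361), any census law.
HONEST LABEL.  Count-neutral residue counting; nothing printed is asserted; (d″-Q), ‹K6-(f′)›, ‹CORE›, β₂ stay HYPOTHESES; `HC_CM` is proved only modulo the 7 printed citations
(2 remaining named inputs: hLiu418 = `stmt-HodgeConjecture-24832`, h413 = `stmt-HodgeConjecture-24833`) until rung 0 closes.
## References
* [Serre1979] J.-P. Serre, *Local Fields*, GTM 67 (1979): Ch. II §4 Prop. 5 (p. 32: representatives ∕ digit expansions), Ch. IV §2 Prop. 6, Ch. I §6 Prop. 18 (totally ramified: same residue field).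
* [Kottwitz1986BaseChangeUnits] R. E. Kottwitz, *Base change for unit elements of Hecke algebras*, Compositio Math. 60 (1986): §1 pp. 240–241 (cell-by-cell lattice bookkeeping).
-/

set_option autoImplicit false

namespace Summit.HodgeConjecture.HodgeConjecture.Cruxes.H413.F0P3cDyRamOneChartDigitTotals

open WithZero Finset
open scoped Valued
open Literature.NumberTheory.Automorphic.UnitaryThreeFourFrame (IsRamifiedQuadraticDatum)
open Literature.NumberTheory.LocalFields.WildQuadraticDatum (v_varpi_pow)
open Summit.HodgeConjecture.HodgeConjecture.Cruxes.H413.F0P3cDyRamDiagonalGluedClassRepresentatives (exists_fixed_class_representatives)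
open Summit.HodgeConjecture.HodgeConjecture.Cruxes.H413.F0P3cDyRamDiagonalFixedClassSystems (card_eq_card_of_repr exists_repr_fixedBall_card)

variable {E : Type} [Field E] [Valued E ℤᵐ⁰] {σ : E →+* E} {ϖ : E} {d tE : ℕ}

/-! ## §1 The shell and ball filters of the digit system are representative systems -/

/-- **THE SHELL FILTER IS A REPRESENTATIVE SYSTEM OF ITS EXACT LEVEL.**  `Rd` σ-fixed integral (`hRd1`), covering the σ-fixed integers modulo `|ϖ|^n` (`hRd2`), separated (`hRd3`);
`2t < n`.  THEN `Rd.filter (|·| = |ϖ|^{2t})` lies in, covers (modulo `|ϖ|^n`) and separates the set `{V ∣ σV = V ∧ |V| = |ϖ|^{2t}}` (a representative within `|ϖ|^n < |ϖ|^{2t}` of an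
element of the shell is on the shell). [cite: Serre1979, Ch. IV §2 Prop. 6] -/
theorem filter_level_repr (hϖ : Valued.v ϖ = exp (-1 : ℤ)) (Rd : Finset E) {n : ℕ}
    (hRd1 : ∀ V ∈ Rd, σ V = V ∧ Valued.v V ≤ 1)
    (hRd2 : ∀ V : E, σ V = V → Valued.v V ≤ 1 → ∃ V₀ ∈ Rd, Valued.v (V - V₀) ≤ Valued.v ϖ ^ n)
    (hRd3 : ∀ V ∈ Rd, ∀ V' ∈ Rd, Valued.v (V - V') ≤ Valued.v ϖ ^ n → V = V')
    (t : ℕ) (ht : 2 * t < n) :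
    (∀ g ∈ Rd.filter (fun V => Valued.v V = Valued.v ϖ ^ (2 * t)), g ∈ {V : E | σ V = V ∧ Valued.v V = Valued.v ϖ ^ (2 * t)}) ∧
      (∀ f ∈ {V : E | σ V = V ∧ Valued.v V = Valued.v ϖ ^ (2 * t)}, ∃ g ∈ Rd.filter (fun V => Valued.v V = Valued.v ϖ ^ (2 * t)), Valued.v (f - g) ≤ Valued.v ϖ ^ n) ∧
      (∀ g ∈ Rd.filter (fun V => Valued.v V = Valued.v ϖ ^ (2 * t)), ∀ g' ∈ Rd.filter (fun V => Valued.v V = Valued.v ϖ ^ (2 * t)),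
        Valued.v (g - g') ≤ Valued.v ϖ ^ n → g = g') := by
  have hϖ1 : Valued.v ϖ ≤ 1 := by rw [hϖ, ← exp_zero, exp_le_exp]; norm_num
  have hlt : Valued.v ϖ ^ n < Valued.v ϖ ^ (2 * t) := by
    rw [v_varpi_pow hϖ, v_varpi_pow hϖ, exp_lt_exp]; omega
  refine ⟨fun g hg => ?_, fun f hf => ?_, fun g hg g' hg' h => hRd3 g (mem_filter.1 hg).1 g' (mem_filter.1 hg').1 h⟩
  · exact ⟨(hRd1 g (mem_filter.1 hg).1).1, (mem_filter.1 hg).2⟩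
  · obtain ⟨hσf, hvf⟩ := hf
    have hf1 : Valued.v f ≤ 1 := by rw [hvf]; exact pow_le_one₀ zero_le hϖ1
    obtain ⟨g, hgR, hfg⟩ := hRd2 f hσf hf1
    refine ⟨g, mem_filter.2 ⟨hgR, ?_⟩, hfg⟩
    have hsmall : Valued.v (g - f) < Valued.v f := by rw [Valuation.map_sub_swap, hvf]; exact lt_of_le_of_lt hfg hlt
    rw [show g = f + (g - f) by ring, Valuation.map_add_eq_of_lt_left _ hsmall, hvf]

/-- **THE BALL FILTER IS A REPRESENTATIVE SYSTEM OF ITS BALL** (`2t ≤ n`: a representative within `|ϖ|^n ≤ |ϖ|^{2t}` of an element of the ball is in the ball). [cite: Serre1979, Ch. IV §2 Prop. 6] -/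
theorem filter_ball_repr (hϖ : Valued.v ϖ = exp (-1 : ℤ)) (Rd : Finset E) {n : ℕ}
    (hRd1 : ∀ V ∈ Rd, σ V = V ∧ Valued.v V ≤ 1)
    (hRd2 : ∀ V : E, σ V = V → Valued.v V ≤ 1 → ∃ V₀ ∈ Rd, Valued.v (V - V₀) ≤ Valued.v ϖ ^ n)
    (hRd3 : ∀ V ∈ Rd, ∀ V' ∈ Rd, Valued.v (V - V') ≤ Valued.v ϖ ^ n → V = V')
    (t : ℕ) (ht : 2 * t ≤ n) :
    (∀ g ∈ Rd.filter (fun V => Valued.v V ≤ Valued.v ϖ ^ (2 * t)), g ∈ {V : E | σ V = V ∧ Valued.v V ≤ Valued.v ϖ ^ (2 * t)}) ∧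
      (∀ f ∈ {V : E | σ V = V ∧ Valued.v V ≤ Valued.v ϖ ^ (2 * t)}, ∃ g ∈ Rd.filter (fun V => Valued.v V ≤ Valued.v ϖ ^ (2 * t)), Valued.v (f - g) ≤ Valued.v ϖ ^ n) ∧
      (∀ g ∈ Rd.filter (fun V => Valued.v V ≤ Valued.v ϖ ^ (2 * t)), ∀ g' ∈ Rd.filter (fun V => Valued.v V ≤ Valued.v ϖ ^ (2 * t)),
        Valued.v (g - g') ≤ Valued.v ϖ ^ n → g = g') := by
  have hϖ1 : Valued.v ϖ ≤ 1 := by rw [hϖ, ← exp_zero, exp_le_exp]; norm_num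
  have hle : Valued.v ϖ ^ n ≤ Valued.v ϖ ^ (2 * t) := pow_le_pow_right_of_le_one' hϖ1 ht
  refine ⟨fun g hg => ?_, fun f hf => ?_, fun g hg g' hg' h => hRd3 g (mem_filter.1 hg).1 g' (mem_filter.1 hg').1 h⟩
  · exact ⟨(hRd1 g (mem_filter.1 hg).1).1, (mem_filter.1 hg).2⟩
  · obtain ⟨hσf, hvf⟩ := hf
    have hf1 : Valued.v f ≤ 1 := hvf.trans (pow_le_one₀ zero_le hϖ1)
    obtain ⟨g, hgR, hfg⟩ := hRd2 f hσf hf1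
    refine ⟨g, mem_filter.2 ⟨hgR, ?_⟩, hfg⟩
    rw [show g = f + -(f - g) by ring]
    exact (Valuation.map_add _ _ _).trans (max_le hvf (by rw [Valuation.map_neg]; exact hfg.trans hle))

/-! ## §2 The two counts -/

/-- **THE SHELL COUNT**: under the wild datum (`σ² = 1`, `v∘σ = v`, even fixed valuations, `|ϖ| = exp(−1)`, `|ϖ − σϖ| = |ϖ|^d`) and a finite residue field, a σ-fixed integral digit
system modulo `|ϖ|^n` has exactly `(q − 1)·q^{⌈(n−2t)∕2⌉ − 1}` members of valuation `|ϖ|^{2t}` whenever `2t < n` (★ `exists_fixed_class_representatives` at `ρ = n − 2t`, ★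
`card_eq_card_of_repr`). [cite: Serre1979, Ch. II §4 Prop. 5 (p. 32); Ch. I §6 Prop. 18] -/
theorem card_filter_level_eq [Finite 𝓀[E]] (hD : IsRamifiedQuadraticDatum σ ϖ d tE) (Rd : Finset E) {n : ℕ}
    (hRd1 : ∀ V ∈ Rd, σ V = V ∧ Valued.v V ≤ 1)
    (hRd2 : ∀ V : E, σ V = V → Valued.v V ≤ 1 → ∃ V₀ ∈ Rd, Valued.v (V - V₀) ≤ Valued.v ϖ ^ n)
    (hRd3 : ∀ V ∈ Rd, ∀ V' ∈ Rd, Valued.v (V - V') ≤ Valued.v ϖ ^ n → V = V')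
    (t : ℕ) (ht : 2 * t < n) :
    (Rd.filter fun V => Valued.v V = Valued.v ϖ ^ (2 * t)).card = (Nat.card 𝓀[E] - 1) * Nat.card 𝓀[E] ^ ((n - 2 * t + 1) / 2 - 1) := by
  classical
  obtain ⟨hσσ, hvσ, hϖ, hfix, hd, -, -⟩ := hD
  obtain ⟨h1, h2, h3⟩ := filter_level_repr hϖ Rd hRd1 hRd2 hRd3 t ht
  obtain ⟨R, hRfin, hRcard, hR1, hR2, hR3⟩ := exists_fixed_class_representatives hσσ hvσ hfix hϖ hd (n - 2 * t) t (by omega)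
  have hmod : n - 2 * t + 2 * t = n := by omega
  rw [hmod] at hR2 hR3
  rw [← hRcard, Set.ncard_eq_toFinset_card R hRfin]
  refine card_eq_card_of_repr (A := {V : E | σ V = V ∧ Valued.v V = Valued.v ϖ ^ (2 * t)}) (r := Valued.v ϖ ^ n) _ _ h1 h2 h3
    (fun g hg => hR1 g ((Set.Finite.mem_toFinset hRfin).1 hg)) (fun f hf => ?_)
    (fun g hg g' hg' h => hR3 g ((Set.Finite.mem_toFinset hRfin).1 hg) g' ((Set.Finite.mem_toFinset hRfin).1 hg') h)
  obtain ⟨g, hgR, hfg⟩ := hR2 f hf.1 hf.2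
  exact ⟨g, (Set.Finite.mem_toFinset hRfin).2 hgR, hfg⟩

/-- **THE BALL COUNT**: likewise the members of valuation `≤ |ϖ|^{2t}` number `q^{⌈(n−2t)∕2⌉}` whenever `2t ≤ n` (★ `exists_repr_fixedBall_card` at `ρ = n − 2t`, ★ `card_eq_card_of_repr`).
[cite: Serre1979, Ch. II §4 Prop. 5 (p. 32); Ch. I §6 Prop. 18] -/
theorem card_filter_ball_eq [Finite 𝓀[E]] (hD : IsRamifiedQuadraticDatum σ ϖ d tE) (Rd : Finset E) {n : ℕ}
    (hRd1 : ∀ V ∈ Rd, σ V = V ∧ Valued.v V ≤ 1)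
    (hRd2 : ∀ V : E, σ V = V → Valued.v V ≤ 1 → ∃ V₀ ∈ Rd, Valued.v (V - V₀) ≤ Valued.v ϖ ^ n)
    (hRd3 : ∀ V ∈ Rd, ∀ V' ∈ Rd, Valued.v (V - V') ≤ Valued.v ϖ ^ n → V = V')
    (t : ℕ) (ht : 2 * t ≤ n) :
    (Rd.filter fun V => Valued.v V ≤ Valued.v ϖ ^ (2 * t)).card = Nat.card 𝓀[E] ^ ((n - 2 * t + 1) / 2) := by
  classical
  obtain ⟨hσσ, hvσ, hϖ, hfix, hd, -, -⟩ := hD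
  obtain ⟨h1, h2, h3⟩ := filter_ball_repr hϖ Rd hRd1 hRd2 hRd3 t ht
  obtain ⟨S, hS1, hS2, hS3, hScard⟩ := exists_repr_fixedBall_card hσσ hvσ hfix hϖ hd (n - 2 * t) t
  have hmod : n - 2 * t + 2 * t = n := by omega
  rw [hmod] at hS2 hS3
  rw [← hScard]
  exact card_eq_card_of_repr (A := {V : E | σ V = V ∧ Valued.v V ≤ Valued.v ϖ ^ (2 * t)}) (r := Valued.v ϖ ^ n) _ _ h1 h2 h3
    hS1 (fun f hf => hS2 f hf.1 hf.2) hS3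

/-! ## §3 HEAD — shell `N − i` against the diagonal ball -/

/-- **HEAD — «THE DIGIT TOTALS OF THE ONE CHART».**  A σ-fixed integral digit system `Rd` modulo `|ϖ|^n` in the one chart of top index `N` (`2N + 1 ≤ n`: the modulus splits the
diagonal ball): for `1 ≤ i ≤ N` the shell `|V| = |ϖ|^{2(N−i)}` (= the sphere of the tower `(b + 2i, b)`, ★ `sphereClause_oneChart_tower_iff` with `|ξ₀| = exp 2N`) holds
`(q − 1)·q^{i−1}·β` digits, `β := #(Rd.filter (|·| ≤ |ϖ|^{2N}))` the digits of the diagonal ball (★ `sphereClause_oneChart_diag_iff`).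
[cite: Serre1979, Ch. II §4 Prop. 5 (p. 32); Ch. I §6 Prop. 18] [cite: Kottwitz1986BaseChangeUnits, §1 pp. 240–241] -/
theorem card_filter_shell_eq_mul_card_ball [Finite 𝓀[E]] (hD : IsRamifiedQuadraticDatum σ ϖ d tE) (Rd : Finset E) {n : ℕ}
    (hRd1 : ∀ V ∈ Rd, σ V = V ∧ Valued.v V ≤ 1)
    (hRd2 : ∀ V : E, σ V = V → Valued.v V ≤ 1 → ∃ V₀ ∈ Rd, Valued.v (V - V₀) ≤ Valued.v ϖ ^ n)
    (hRd3 : ∀ V ∈ Rd, ∀ V' ∈ Rd, Valued.v (V - V') ≤ Valued.v ϖ ^ n → V = V')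
    {N : ℕ} (hN : 2 * N + 1 ≤ n) (i : ℕ) (hi1 : 1 ≤ i) (hiN : i ≤ N) :
    (Rd.filter fun V => Valued.v V = Valued.v ϖ ^ (2 * (N - i))).card =
      (Nat.card 𝓀[E] - 1) * Nat.card 𝓀[E] ^ (i - 1) * (Rd.filter fun V => Valued.v V ≤ Valued.v ϖ ^ (2 * N)).card := by
  rw [card_filter_level_eq hD Rd hRd1 hRd2 hRd3 (N - i) (by omega), card_filter_ball_eq hD Rd hRd1 hRd2 hRd3 N (by omega), mul_assoc, ← pow_add]
  congr 2
  omega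

/-- **THE DIAGONAL BALL IS POPULATED**: `β = #(Rd.filter (|·| ≤ |ϖ|^{2N})) = q^{⌈(n−2N)∕2⌉} ≠ 0` (`2N ≤ n`; `q = Nat.card 𝓀[E] ≥ 1`). [cite: Serre1979, Ch. II §4 Prop. 5 (p. 32)] -/
theorem card_filter_ball_ne_zero [Finite 𝓀[E]] (hD : IsRamifiedQuadraticDatum σ ϖ d tE) (Rd : Finset E) {n : ℕ}
    (hRd1 : ∀ V ∈ Rd, σ V = V ∧ Valued.v V ≤ 1)
    (hRd2 : ∀ V : E, σ V = V → Valued.v V ≤ 1 → ∃ V₀ ∈ Rd, Valued.v (V - V₀) ≤ Valued.v ϖ ^ n)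
    (hRd3 : ∀ V ∈ Rd, ∀ V' ∈ Rd, Valued.v (V - V') ≤ Valued.v ϖ ^ n → V = V')
    {N : ℕ} (hN : 2 * N ≤ n) :
    (Rd.filter fun V => Valued.v V ≤ Valued.v ϖ ^ (2 * N)).card ≠ 0 := by
  rw [card_filter_ball_eq hD Rd hRd1 hRd2 hRd3 N hN]
  exact pow_ne_zero _ (Nat.card_pos (α := 𝓀[E])).ne'

end Summit.HodgeConjecture.HodgeConjecture.Cruxes.H413.F0P3cDyRamOneChartDigitTotals
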